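import Summits.ResolutionOfSingularities.ResolutionOfSingularities.Theorems.ValuativeLuAlphaPTorsorContentRefined
import Summits.ResolutionOfSingularities.ResolutionOfSingularities.Theorems.ValuativeLuAlphaPTorsorContentOrigin
import Literature.AlgebraicGeometry.Resolution.QuadraticTransformsKeyLemma

/-!
# Giraud's free-chart formula for the log-content of a quadratic transform

Helper file for the stub `content_free_chart` (F1, Giraud 1983 §2.5 in tree language) of the
line `pfaff-line-log-final-forms` (crux `Valuative.LuAlphaPTorsor`, item
`stmt-ResolutionOfSingularities-0641`).

Setting: `K` a field, `O ⊆ K` a valuation ring, `R ⊆ R₁ ⊆ K` with `R` a two-dimensional regular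
local ring and `R₁` its quadratic transform along `O` (`IsQuadraticTransformAlong O R R₁`),
`φ : R → R₁` the inclusion. Let `u : Fin 2 → R` be a regular system of parameters with dual
`ℤ`-derivations `D_i (u_j) = δ_ij`, let `x := u i₀` have MINIMAL value in `𝔪_R` (so `x ≠ 0`),
and let `u' : Fin 2 → R₁` be the chart coordinates `u' i₀ = x`, `u' j = u_j / x` (`j ≠ i₀`).
For a boundary `E` write `C_E(a) := Ideal.span {δ a | δ ∈ Der_ℤ, δ (u_i) ∈ (u_i) ∀ i ∈ E}` for the
LOG-CONTENT IDEAL. With boundary `{x}` on the side of `R₁` (only `u' i₀ = x` logarithmic):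

  `C_{x}(φ f; R₁) = C_univ(f; R) · R₁ + x · C_{x}(f; R) · R₁`     (`content_free_chart`).

* `≥`: `C_univ(f; R) · R₁ ≤ C_univ(φ f; R₁) ≤ C_{x}(φ f; R₁)`
  (`content_map_le_quadraticTransform_origin`); and for any `δ ∈ Der_ℤ(R)` the derivation
  `x δ` maps `𝔪_R` into itself, hence extends to `δ₁ ∈ Der_ℤ(R₁)`
  (`exists_derivation_quadraticTransformAlong`) with `δ₁ x = x φ(δ x) ∈ (x)` and
  `x φ(δ f) = δ₁ (φ f)`.
* `≤`: by the refined round lemma (`content_le_map_univ_sup_of_rich`),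
  `C_{x}(φ f; R₁) ≤ C_univ(f; R) · R₁ + ∑_i I_i · (φ (D_i f))` with
  `I_i = ({x}-log δ') (φ u_i) ⊆ (x)` (`φ u_{i₀} = x`, `φ u_j = x · u'_j`); then
  `x · φ(D_{i₀} f) = φ ((x D_{i₀}) f)` with `x D_{i₀}` everywhere logarithmic, and for `j ≠ i₀`
  the dual derivation `D_j` is `{x}`-logarithmic (`D_j x = 0`).

References: J. Giraud, *Forme normale d'une fonction sur une surface de caractéristique
positive*, Bull. SMF 111 (1983), §2.5.
-/

set_option linter.dupNamespace false

namespace Summit.ResolutionOfSingularities.ResolutionOfSingularities.Theorems.PfaffLine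

open IsLocalRing Literature.AlgebraicGeometry.Resolution

section FreeChart

variable {K : Type} [Field K]

/-- For `x ∈ R ⊆ K` of minimal value in the maximal ideal of a two-dimensional regular local
ring `R`: `x ≠ 0` in `K` (otherwise `𝔪_R = 0` would be principal). [folklore] -/
theorem coe_ne_zero_of_minimal_value_freeChart {R : Subring K} [IsRegularLocalRing R]
    (O : ValuationSubring K) (hdim : ringKrullDim R = 2) {x : R}
    (hmin : ∀ z ∈ maximalIdeal R, O.valuation (z : K) ≤ O.valuation ((x : R) : K)) :
    ((x : R) : K) ≠ 0 := by
  intro hx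
  apply maximalIdeal_ne_span_singleton hdim (0 : R)
  rw [Ideal.span_singleton_zero, eq_bot_iff]
  intro z hz
  have h1 := hmin z hz
  rw [hx, map_zero, le_zero_iff, map_eq_zero] at h1
  exact (Submodule.mem_bot R).mpr (ZeroMemClass.coe_eq_zero.mp h1)

/-- **`x · C_E(f; R) · R₁ ≤ C_{x}(φ f; R₁)`**: for every `ℤ`-derivation `δ` of the local ring
`R`, the derivation `x δ` (`x = u i₀ ∈ 𝔪_R`) maps `𝔪_R` into itself, hence extends to a
derivation `δ₁` of the quadratic transform `R₁` (`exists_derivation_quadraticTransformAlong`);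
`δ₁` is logarithmic along `u' i₀ = x` (`δ₁ x = x · φ (δ x)`) and `x · φ (δ f) = δ₁ (φ f)`.
[folklore] -/
theorem span_mul_map_content_le_freeChart (O : ValuationSubring K) (R R₁ : Subring K)
    [IsLocalRing R] (h : IsQuadraticTransformAlong O R R₁) {d : ℕ} (u : Fin d → R)
    (hspan : Ideal.span (Set.range u) = maximalIdeal R) (i₀ : Fin d) (u' : Fin d → R₁)
    (hi₀ : (u' i₀ : K) = (u i₀ : K)) (E : Finset (Fin d)) (f : R) :
    Ideal.span {Subring.inclusion h.le (u i₀)} *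
      (Ideal.span {b | ∃ δ : Derivation ℤ R R, (∀ i ∈ E, δ (u i) ∈ Ideal.span {u i}) ∧
        δ f = b}).map (Subring.inclusion h.le) ≤
    Ideal.span {b | ∃ δ' : Derivation ℤ R₁ R₁,
      (∀ j ∈ ({i₀} : Finset (Fin d)), δ' (u' j) ∈ Ideal.span {u' j}) ∧
        δ' (Subring.inclusion h.le f) = b} := by
  have hxm : u i₀ ∈ maximalIdeal R := hspan ▸ Ideal.subset_span (Set.mem_range_self i₀)
  have h0 : u' i₀ = Subring.inclusion h.le (u i₀) := Subtype.ext hi₀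
  rw [Ideal.map_span, Ideal.span_mul_span', Ideal.span_le]
  rintro _ ⟨a, ha, _, ⟨_, ⟨δ, -, rfl⟩, rfl⟩, rfl⟩
  rw [Set.mem_singleton_iff] at ha
  subst ha
  -- extend `x δ` to the quadratic transform
  obtain ⟨δ₁, hδ₁⟩ := exists_derivation_quadraticTransformAlong O R R₁ h (u i₀ • δ)
    (fun z _ => by
      rw [Derivation.smul_apply, smul_eq_mul]
      exact Ideal.mul_mem_right _ _ hxm)
  have hδ₁' : ∀ z, δ₁ (Subring.inclusion h.le z) =
      Subring.inclusion h.le (u i₀) * Subring.inclusion h.le (δ z) := fun z => by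
    rw [hδ₁, Derivation.smul_apply, smul_eq_mul, map_mul]
  refine Ideal.subset_span ⟨δ₁, ?_, hδ₁' f⟩
  intro j hj
  rw [Finset.mem_singleton] at hj
  rw [hj, h0, hδ₁']
  exact Ideal.mul_mem_right _ _ (Ideal.mem_span_singleton_self _)

/-- **`C_univ(f; R) · R₁ ≤ C_{x}(φ f; R₁)`**: the total transform of the full-boundary content
lies in the full-boundary content of `φ f` along the chart coordinates `u'`
(`content_map_le_quadraticTransform_origin`), which lies in the content with the smaller
boundary `{x}` (fewer logarithmic conditions, more derivations). [folklore] -/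
theorem map_content_univ_le_freeChart (O : ValuationSubring K) (R R₁ : Subring K)
    [IsLocalRing R] (h : IsQuadraticTransformAlong O R R₁) {d : ℕ} (u : Fin d → R)
    (hspan : Ideal.span (Set.range u) = maximalIdeal R) (i₀ : Fin d) (hx : (u i₀ : K) ≠ 0)
    (u' : Fin d → R₁) (hi₀ : (u' i₀ : K) = (u i₀ : K))
    (hj : ∀ j, j ≠ i₀ → (u' j : K) = (u j : K) / (u i₀ : K)) (f : R) :
    (Ideal.span {b | ∃ δ : Derivation ℤ R R,
        (∀ i ∈ (Finset.univ : Finset (Fin d)), δ (u i) ∈ Ideal.span {u i}) ∧ δ f = b}).map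
      (Subring.inclusion h.le) ≤
    Ideal.span {b | ∃ δ' : Derivation ℤ R₁ R₁,
      (∀ j ∈ ({i₀} : Finset (Fin d)), δ' (u' j) ∈ Ideal.span {u' j}) ∧
        δ' (Subring.inclusion h.le f) = b} := by
  refine (content_map_le_quadraticTransform_origin O R R₁ h u hspan i₀ hx u' hi₀ hj f).trans
    (Ideal.span_mono ?_)
  rintro b ⟨δ', hδ', hb⟩
  exact ⟨δ', fun j _ => hδ' j (Finset.mem_univ j), hb⟩

/-- **`C_{x}(φ f; R₁) ≤ C_univ(f; R) · R₁ + x · C_{x}(f; R) · R₁`**: by the refined round lemma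
(`content_le_map_univ_sup_of_rich`) it remains to bound the boundary terms `I_i · (φ (D_i f))`,
where `I_i` is generated by the values `δ' (φ u_i)` of the `{x}`-logarithmic derivations `δ'` of
`R₁`. Since `φ u_{i₀} = x` and `φ u_j = u'_j · x`, every `I_i` lies in `(x)`; then
`x · φ (D_{i₀} f) = φ ((x D_{i₀}) f)` with `x D_{i₀}` logarithmic along every `u_i`, and for
`j ≠ i₀` the dual derivation `D_j` kills `x`, so `φ (D_j f) ∈ C_{x}(f; R) · R₁`. [folklore] -/
theorem content_freeChart_le (O : ValuationSubring K) (R R₁ : Subring K)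
    (h : IsQuadraticTransformAlong O R R₁)
    (hrich : ∀ (N : Type) [CommRing N] (ψ : R →+* N) (δ₀ : R →+ N),
      (∀ a b, δ₀ (a * b) = ψ a * δ₀ b + ψ b * δ₀ a) → ∀ Y : Finset R,
      ∃ (m : ℕ) (Δ : Fin m → Derivation ℤ R R) (nn : Fin m → N),
        ∀ y ∈ Y, δ₀ y = Finset.univ.sum fun j => ψ (Δ j y) * nn j)
    {d : ℕ} (u : Fin d → R) (D : Fin d → Derivation ℤ R R)
    (hD : ∀ i j, D i (u j) = if i = j then 1 else 0) (i₀ : Fin d) (hx : (u i₀ : K) ≠ 0)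
    (u' : Fin d → R₁) (hi₀ : (u' i₀ : K) = (u i₀ : K))
    (hj : ∀ j, j ≠ i₀ → (u' j : K) = (u j : K) / (u i₀ : K)) (f : R) :
    Ideal.span {b | ∃ δ' : Derivation ℤ R₁ R₁,
      (∀ j ∈ ({i₀} : Finset (Fin d)), δ' (u' j) ∈ Ideal.span {u' j}) ∧
        δ' (Subring.inclusion h.le f) = b} ≤
    (Ideal.span {b | ∃ δ : Derivation ℤ R R,
        (∀ i ∈ (Finset.univ : Finset (Fin d)), δ (u i) ∈ Ideal.span {u i}) ∧ δ f = b}).map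
      (Subring.inclusion h.le) ⊔
    Ideal.span {Subring.inclusion h.le (u i₀)} *
      (Ideal.span {b | ∃ δ : Derivation ℤ R R,
        (∀ i ∈ ({i₀} : Finset (Fin d)), δ (u i) ∈ Ideal.span {u i}) ∧ δ f = b}).map
      (Subring.inclusion h.le) := by
  refine (content_le_map_univ_sup_of_rich (Subring.inclusion h.le) hrich u D hD u' {i₀} f).trans
    (sup_le le_sup_left (iSup_le fun i => ?_))
  have h0 : Subring.inclusion h.le (u i₀) = u' i₀ := (Subtype.ext hi₀).symm
  -- the ideal `I_i` of values `δ' (φ u_i)` lies in `(x)`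
  have hI : Ideal.span {b | ∃ δ' : Derivation ℤ R₁ R₁,
      (∀ j ∈ ({i₀} : Finset (Fin d)), δ' (u' j) ∈ Ideal.span {u' j}) ∧
        δ' (Subring.inclusion h.le (u i)) = b} ≤ Ideal.span {Subring.inclusion h.le (u i₀)} := by
    rw [Ideal.span_le]
    rintro _ ⟨δ', hδ', rfl⟩
    have hlog : δ' (u' i₀) ∈ Ideal.span {u' i₀} := hδ' i₀ (Finset.mem_singleton_self i₀)
    rw [SetLike.mem_coe, h0]
    by_cases hi : i = i₀
    · rw [hi, h0]
      exact hlog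
    · have hmul : Subring.inclusion h.le (u i) = u' i * u' i₀ := Subtype.ext (by
        rw [Subring.coe_mul, hj i hi, hi₀, Subring.coe_inclusion]
        exact (div_mul_cancel₀ _ hx).symm)
      rw [hmul, Derivation.leibniz, smul_eq_mul, smul_eq_mul]
      exact add_mem (Ideal.mul_mem_left _ _ hlog)
        (Ideal.mul_mem_right _ _ (Ideal.mem_span_singleton_self _))
  by_cases hi : i = i₀
  · -- `x · φ (D_{i₀} f) = φ ((x D_{i₀}) f)` with `x D_{i₀}` everywhere logarithmic
    refine le_sup_of_le_left ((Ideal.mul_mono_left hI).trans ?_)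
    rw [Ideal.span_singleton_mul_span_singleton, ← map_mul, Ideal.span_singleton_le_iff_mem]
    refine Ideal.mem_map_of_mem _ (Ideal.subset_span ⟨u i₀ • D i, fun j _ => ?_, by
      rw [Derivation.smul_apply, smul_eq_mul]⟩)
    rw [Derivation.smul_apply, smul_eq_mul, hD]
    by_cases hji : i = j
    · rw [if_pos hji, mul_one, ← hji, hi]
      exact Ideal.mem_span_singleton_self _
    · rw [if_neg hji, mul_zero]
      exact zero_mem _
  · -- `D_j` is `{x}`-logarithmic for `j ≠ i₀`
    refine le_sup_of_le_right ((Ideal.mul_mono_left hI).trans (Ideal.mul_mono_right ?_))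
    rw [Ideal.span_singleton_le_iff_mem]
    refine Ideal.mem_map_of_mem _ (Ideal.subset_span ⟨D i, fun j hj' => ?_, rfl⟩)
    rw [Finset.mem_singleton] at hj'
    rw [hj', hD, if_neg hi]
    exact zero_mem _

end FreeChart

/-- **Registered stub `content_free_chart`** (F1: Giraud 1983 §2.5, the free-chart content
formula, in tree language). At a point of the `x`-chart of the quadratic transform `R₁` of the
two-dimensional regular local ring `R ⊆ K` along `O` (`x = u i₀` of minimal value, chart
coordinates `u' i₀ = x`, `u' j = u_j / x`), with boundary `{x}` on the side of `R₁`, the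
log-content of `f` is `C_{x}(φ f; R₁) = C_univ(f; R) · R₁ + x · C_{x}(f; R) · R₁`. The three
inclusions are `content_freeChart_le`, `map_content_univ_le_freeChart` and
`span_mul_map_content_le_freeChart`. [folklore] -/
theorem content_free_chart : ∀ {K : Type} [Field K] (O : ValuationSubring K) (R R₁ : Subring K) [IsRegularLocalRing R] [IsLocalRing R₁] (h : Literature.AlgebraicGeometry.Resolution.IsQuadraticTransformAlong O R R₁), ringKrullDim R = 2 → Literature.AlgebraicGeometry.Resolution.SubringDominates R O.toSubring → (∀ (N : Type) [CommRing N] (ψ : R →+* N) (δ₀ : R →+ N), (∀ a b, δ₀ (a * b) = ψ a * δ₀ b + ψ b * δ₀ a) → ∀ Y : Finset R, ∃ (m : ℕ) (Δ : Fin m → Derivation ℤ R R) (nn : Fin m → N), ∀ y ∈ Y, δ₀ y = Finset.univ.sum fun j => ψ (Δ j y) * nn j) → ∀ (u : Fin 2 → R) (D : Fin 2 → Derivation ℤ R R), (∀ i j, D i (u j) = if i = j then 1 else 0) → Ideal.span (Set.range u) = maximalIdeal R → ∀ (i₀ : Fin 2), (∀ z ∈ maximalIdeal R, O.valuation (z :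 K) ≤ O.valuation ((u i₀ : R) : K)) → ∀ (u' : Fin 2 → R₁), ((u' i₀ : R₁) : K) = ((u i₀ : R) : K) → (∀ j, j ≠ i₀ → ((u' j : R₁) : K) = ((u j : R) : K) / ((u i₀ : R) : K)) → ∀ (f : R), Ideal.span {b | ∃ δ' : Derivation ℤ R₁ R₁, (∀ j ∈ ({i₀} : Finset (Fin 2)), δ' (u' j) ∈ Ideal.span {u' j}) ∧ δ' (Subring.inclusion h.le f) = b} = (Ideal.span {b | ∃ δ : Derivation ℤ R R, (∀ i ∈ (Finset.univ : Finset (Fin 2)), δ (u i) ∈ Ideal.span {u i}) ∧ δ f = b}).map (Subring.inclusion h.le) ⊔ Ideal.span {Subring.inclusion h.le (u i₀)} * (Ideal.span {b | ∃ δ : Derivation ℤ R R, (∀ i ∈ ({i₀} : Finset (Fin 2)), δ (u i) ∈ Ideal.span {u i}) ∧ δ f = b}).map (Subring.inclusion h.le) := by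
  intro K _ O R R₁ _ _ h hdim _ hrich u D hD hspan i₀ hmin u' hi₀ hj f
  have hx : ((u i₀ : R) : K) ≠ 0 := coe_ne_zero_of_minimal_value_freeChart O hdim hmin
  exact le_antisymm (content_freeChart_le O R R₁ h hrich u D hD i₀ hx u' hi₀ hj f)
    (sup_le (map_content_univ_le_freeChart O R R₁ h u hspan i₀ hx u' hi₀ hj f)
      (span_mul_map_content_le_freeChart O R R₁ h u hspan i₀ u' hi₀ {i₀} f))

end Summit.ResolutionOfSingularities.ResolutionOfSingularities.Theorems.PfaffLine
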